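import Mathlib.LinearAlgebra.ExteriorPower.Basic
import Mathlib.LinearAlgebra.Eigenspace.Basic
import Mathlib.NumberTheory.NumberField.CMField
import Mathlib.NumberTheory.NumberField.InfinitePlace.Embeddings
import Mathlib.RingTheory.Norm.Defs
import Mathlib.RingTheory.Trace.Defs
import Literature.AlgebraicGeometry.Motives.HodgeStructure
import HarnessLib

-- provenance: harness21/H21/H21/Prelude/MotiveAbstract/WeilTypeCM.lean @ cb8327e (interim HEAD d8f2665); M5 mechanical rewrite
/-!
# Weil type and CM type as Hodge-linear algebra (trunk `MotiveAbstract`, item C7)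

Linear algebra of a pure `ℚ`-Hodge structure `H : HodgeStructure V n` (think `n = 1`,
`V = H¹(A, ℚ)` for an abelian variety `A`, `dim V = 2 dim A`) equipped with an action of a
number field `E` by endomorphisms of Hodge structures; no geometry.

* `Literature.HodgeStructure.EndAction H E`: an action `ι : E →ₐ[ℚ] End_ℚ V` preserving the Hodge
  filtration.
* `eigenPiece A σ p q ⊆ V^{p,q}`: the `σ`-eigenspace of `E` in the Hodge piece `V^{p,q}`, for a
  complex embedding `σ : E →+* ℂ`; `multiplicity A σ = dim_ℂ (V^{1,0})_σ`
  (Deligne, *Hodge cycles on abelian varieties*, LNM 900, §4–5; Moonen–Zarhin, *Hodge classes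
  and Tate classes on simple abelian fourfolds*, Duke Math. J. 77 (1995), §2).
* `IsOfWeilType A`: `E` imaginary quadratic and every `σ` occurs in `V^{1,0}` with multiplicity
  `dim V^{1,0} / 2` (Weil 1977; van Geemen, *An introduction to the Hodge conjecture for abelian
  varieties*, 1994, §5; Moonen–Zarhin 1995, §2).
* `derivationExteriorPower φ n`: the derivation `D_φ (v₁ ∧ ⋯ ∧ vₙ) = Σᵢ v₁ ∧ ⋯ ∧ φ vᵢ ∧ ⋯ ∧ vₙ`
  of `⋀[R]^n M` extending `φ : End_R M` (Lie-algebra action on exterior powers), built from the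
  universal property `exteriorPower.alternatingMapLinearEquiv`; a real definition.
* `weilClasses A g ⊆ ⋀[ℚ]^g V`: the space of Weil classes `⋀^g_E V ⊂ ⋀^g_ℚ V`, cut out by the
  infinitesimal (Lie-algebra) characterisation, see its docstring; `finrank_weilClasses`.
* `CMType E`, `IsCM A`, `cmType A`, `mem_cmType_iff_conjugate_notMem`: CM types
  (Shimura–Taniyama; Deligne LNM 900 §5; Milne, *Complex Multiplication*, §1).

## Mathlib

Mathlib has `exteriorPower`, `exteriorPower.ιMulti`, `exteriorPower.alternatingMapLinearEquiv`,
`Module.End.eigenspace`, `NumberField.IsTotallyComplex`, `NumberField.IsCMField`,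
`NumberField.ComplexEmbedding.conjugate`, `Algebra.trace`, `Algebra.norm`, all used here. It has
no CM types (`rg CMType`: nothing), no Weil-type notion and no derivation action on exterior
powers (`rg derivation Mathlib/LinearAlgebra/ExteriorPower`: nothing).

## Design

The number field is `(E : Type*) [Field E] [NumberField E]`; its `ℚ`-algebra structure is
Mathlib's canonical `DivisionRing.toRatAlgebra` (so we do not take a separate `[Algebra ℚ E]`,
which would clash with it). `EndAction` asks for `[NumberField E]` from the start although
`eigenPiece`/`weilClasses` only use `[Field E]`: this loss of generality is deliberate, all
intended uses being number fields.
`multiplicity`, `IsOfWeilType`, `IsCM`, `cmType` refer to the piece `V^{1,0}` and are stated for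
weight `1`. Since `Literature.HodgeStructure V 1` does not force the Hodge types to be `(1,0), (0,1)`
(no effectivity is built in), `IsOfWeilType` and `IsCM` include the conjunct `H.IsEffective`
(for weight `1` exactly "types `(1,0), (0,1)` only", as for `H¹` of an abelian variety), and
`IsOfWeilType` moreover `FiniteDimensional ℚ V`; this deviates from the outline's literal
definitions, which are false/vacuous without it. `CMType E` only assumes `[Field E]`.
-/

open scoped TensorProduct

noncomputable section

namespace Literature.AlgebraicGeometry.Motives

universe u

/-! ### The derivation action of `End M` on `⋀^n M` -/

section Derivation

variable {R : Type*} [CommRing R] {M : Type*} [AddCommGroup M] [Module R M]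

/-- The multilinear map `(v₁, …, vₙ) ↦ Σᵢ v₁ ∧ ⋯ ∧ φ vᵢ ∧ ⋯ ∧ vₙ` underlying
`derivationExteriorPower` (Bourbaki, *Algèbre* III §10.9, dérivations de l'algèbre extérieure). [folklore] -/
def derivationMultilinear (φ : Module.End R M) (n : ℕ) :
    MultilinearMap R (fun _ : Fin n => M) (⋀[R]^n M) :=
  ∑ i : Fin n, (exteriorPower.ιMulti R n).toMultilinearMap.compLinearMap
    (Function.update (fun _ => LinearMap.id) i φ)

/-- `derivationMultilinear φ n v = Σᵢ ιMulti (v with vᵢ replaced by φ vᵢ)`. [folklore] -/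
theorem derivationMultilinear_apply (φ : Module.End R M) (n : ℕ) (v : Fin n → M) :
    derivationMultilinear φ n v =
      ∑ i : Fin n, exteriorPower.ιMulti R n (Function.update v i (φ (v i))) := by
  simp only [derivationMultilinear, FunLike.coe_sum, Finset.sum_apply,
    MultilinearMap.compLinearMap_apply, AlternatingMap.coe_multilinearMap]
  refine Finset.sum_congr rfl fun i _ => ?_
  congr 1
  ext j
  by_cases h : j = i
  · subst h; simp
  · simp [Function.update_of_ne h]

/-- The multilinear map `derivationMultilinear φ n` is alternating. [folklore] -/
theorem derivationMultilinear_eq_zero_of_eq (φ : Module.End R M) (n : ℕ) (v : Fin n → M)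
    (i j : Fin n) (hv : v i = v j) (hij : i ≠ j) : derivationMultilinear φ n v = 0 := by
  rw [derivationMultilinear_apply,
    ← Finset.add_sum_erase _ _ (Finset.mem_univ i),
    ← Finset.add_sum_erase _ _ (Finset.mem_erase.2 ⟨hij.symm, Finset.mem_univ j⟩)]
  have hrest : ∑ k ∈ (Finset.univ.erase i).erase j,
      exteriorPower.ιMulti R n (Function.update v k (φ (v k))) = 0 := by
    refine Finset.sum_eq_zero fun k hk => ?_
    obtain ⟨hkj, hk'⟩ := Finset.mem_erase.1 hk
    obtain ⟨hki, -⟩ := Finset.mem_erase.1 hk'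
    refine AlternatingMap.map_eq_zero_of_eq _ _ ?_ hij
    rw [Function.update_of_ne (Ne.symm hki), Function.update_of_ne (Ne.symm hkj), hv]
  have hswap : Function.update v j (φ (v j)) = Function.update v i (φ (v i)) ∘ Equiv.swap i j := by
    ext k
    by_cases hki : k = i
    · subst hki
      simp [Function.update_of_ne hij, Function.update_of_ne (Ne.symm hij), hv]
    · by_cases hkj : k = j
      · subst hkj
        simp [hv]
      · simp [Equiv.swap_apply_of_ne_of_ne hki hkj, Function.update_of_ne hki,
          Function.update_of_ne hkj]
  rw [hrest, add_zero, hswap, AlternatingMap.map_swap _ _ hij, add_neg_cancel]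

/-- The alternating map `(v₁, …, vₙ) ↦ Σᵢ v₁ ∧ ⋯ ∧ φ vᵢ ∧ ⋯ ∧ vₙ : Mⁿ → ⋀[R]^n M`. [folklore] -/
def derivationAlternating (φ : Module.End R M) (n : ℕ) : M [⋀^Fin n]→ₗ[R] ⋀[R]^n M :=
  { derivationMultilinear φ n with
    map_eq_zero_of_eq' := fun v i j hv hij =>
      derivationMultilinear_eq_zero_of_eq φ n v i j hv hij }

/-- `derivationAlternating` on a tuple. [folklore] -/
theorem derivationAlternating_apply (φ : Module.End R M) (n : ℕ) (v : Fin n → M) :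
    derivationAlternating φ n v =
      ∑ i : Fin n, exteriorPower.ιMulti R n (Function.update v i (φ (v i))) :=
  derivationMultilinear_apply φ n v

/-- The **derivation extension** of an endomorphism `φ` of `M` to the exterior power `⋀[R]^n M`:
the unique `R`-linear map with `D_φ (v₁ ∧ ⋯ ∧ vₙ) = Σᵢ v₁ ∧ ⋯ ∧ φ vᵢ ∧ ⋯ ∧ vₙ`, i.e. the
action of `φ ∈ 𝔤𝔩(M)` on `⋀ⁿ M` as a Lie algebra representation (the derivative at `t = 0` of
`t ↦ ⋀ⁿ(1 + tφ)`). Built from the universal property `exteriorPower.alternatingMapLinearEquiv`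
(Bourbaki, *Algèbre* III §10.9; Fulton–Harris, *Representation Theory*, §B.1). [folklore] -/
def derivationExteriorPower (φ : Module.End R M) (n : ℕ) : Module.End R (⋀[R]^n M) :=
  exteriorPower.alternatingMapLinearEquiv (derivationAlternating φ n)

/-- The defining formula `D_φ (v₁ ∧ ⋯ ∧ vₙ) = Σᵢ v₁ ∧ ⋯ ∧ φ vᵢ ∧ ⋯ ∧ vₙ`. [folklore] -/
theorem derivationExteriorPower_ιMulti (φ : Module.End R M) (n : ℕ) (v : Fin n → M) :
    derivationExteriorPower φ n (exteriorPower.ιMulti R n v) =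
      ∑ i : Fin n, exteriorPower.ιMulti R n (Function.update v i (φ (v i))) := by
  rw [derivationExteriorPower, exteriorPower.alternatingMapLinearEquiv_apply_ιMulti,
    derivationAlternating_apply]

/-- `φ ↦ D_φ` is additive (it is a Lie algebra homomorphism `𝔤𝔩(M) → 𝔤𝔩(⋀ⁿ M)`). [folklore] -/
theorem derivationExteriorPower_add (φ ψ : Module.End R M) (n : ℕ) :
    derivationExteriorPower (φ + ψ) n =
      derivationExteriorPower φ n + derivationExteriorPower ψ n := by
  refine exteriorPower.linearMap_ext ?_
  ext v
  simp only [LinearMap.compAlternatingMap_apply, LinearMap.add_apply,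
    derivationExteriorPower_ιMulti, ← Finset.sum_add_distrib, ← AlternatingMap.map_update_add]

/-- A scalar `c • 1` acts on `⋀ⁿ M` by `D_{c • 1} = (n c) • 1`. [folklore] -/
def derivationExteriorPower_smul_one : Prop :=
  ∀ (c : R) (n : ℕ),
    derivationExteriorPower (c • (1 : Module.End R M)) n = ((n : R) * c) • 1

/-- `D_φ` and `D_ψ` commute when `φ` and `ψ` commute (Lie homomorphism property). [folklore] -/
def commute_derivationExteriorPower : Prop :=
  ∀ {φ ψ : Module.End R M} (h : Commute φ ψ) (n : ℕ),
    Commute (derivationExteriorPower φ n) (derivationExteriorPower ψ n)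

end Derivation

/-! ### Number-field actions on Hodge structures -/

variable {V : Type u} [AddCommGroup V] [Module ℚ V] {n : ℤ}

namespace HodgeStructure

/-- An action of the number field `E` on the Hodge structure `H` by endomorphisms of Hodge
structures: a `ℚ`-algebra map `ι : E → End_ℚ V` such that each `ι e`, complexified, preserves
the Hodge filtration (Deligne, LNM 900, §4; Moonen–Zarhin, Duke 77 (1995), §2: `E ↪ End⁰(A)`
acting on `H¹(A, ℚ)`). [folklore] -/
structure EndAction (H : HodgeStructure V n) (E : Type*) [Field E] [NumberField E] where
  /-- The action `E →ₐ[ℚ] End_ℚ V`. -/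
  ι : E →ₐ[ℚ] Module.End ℚ V
  /-- Each `ι e` is an endomorphism of Hodge structures: `(ι e)_ℂ (F^p) ⊆ F^p`. -/
  map_F_le : ∀ (e : E) (p : ℤ), (H.F p).map ((ι e).baseChange ℂ) ≤ H.F p

namespace EndAction

variable {E : Type*} [Field E] [NumberField E]

section General

variable {H : HodgeStructure V n}

/-- Each `ι e` as a morphism of Hodge structures `H → H` (Deligne, LNM 900, §4). [folklore] -/
def hom (A : EndAction H E) (e : E) : Hom H H where
  toLinearMap := A.ι e
  map_F_le := A.map_F_le e

/-- The `σ`-eigen-subspace of the Hodge piece `V^{p,q}` for a complex embedding `σ : E →+* ℂ`: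
`V^{p,q}_σ = {x ∈ V^{p,q} | ∀ e, (ι e)_ℂ x = σ(e) x}`. Since `E ⊗_ℚ ℂ = ∏_σ ℂ`, one has
`V^{p,q} = ⊕_σ V^{p,q}_σ` (Deligne, LNM 900, §4; Moonen–Zarhin 1995, §2.2). [cite: MoonenZarhin1995, §2.2] -/
def eigenPiece (A : EndAction H E) (σ : E →+* ℂ) (p q : ℤ) : Submodule ℂ (ℂ ⊗[ℚ] V) :=
  H.piece p q ⊓ ⨅ e : E, Module.End.eigenspace ((A.ι e).baseChange ℂ) (σ e)

/-- `V^{p,q}_σ ⊆ V^{p,q}`. [folklore] -/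
theorem eigenPiece_le_piece (A : EndAction H E) (σ : E →+* ℂ) (p q : ℤ) :
    A.eigenPiece σ p q ≤ H.piece p q := inf_le_left

/-- Membership in `eigenPiece`. [folklore] -/
theorem mem_eigenPiece_iff (A : EndAction H E) (σ : E →+* ℂ) (p q : ℤ) (x : ℂ ⊗[ℚ] V) :
    x ∈ A.eigenPiece σ p q ↔ x ∈ H.piece p q ∧ ∀ e : E, (A.ι e).baseChange ℂ x = σ e • x := by
  simp [eigenPiece, Submodule.mem_iInf]

/-- Complex conjugation exchanges `V^{p,q}_σ` and `V^{q,p}_{σ̄}` (Deligne, LNM 900, §4). [cite: DeligneLNM900, §4] -/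
def complexConj_eigenPiece : Prop :=
  ∀ (A : EndAction H E) (σ : E →+* ℂ) (p q : ℤ),
    complexConj (A.eigenPiece σ p q) =
      A.eigenPiece (NumberField.ComplexEmbedding.conjugate σ) q p

/-- Complex conjugation `conj ⊗ id` of `V_ℂ` carries the `μ`-eigenspace of a base-changed
`ℚ`-linear map `f_ℂ = 1 ⊗ f` to its `μ̄`-eigenspace: `conj` commutes with `f_ℂ`
(`conj_baseChange`) and is antilinear (`conj_smul`). Generic linear algebra behind
`complexConj_eigenPiece_holds`. [folklore] -/
theorem complexConj_eigenspace_baseChange (f : V →ₗ[ℚ] V) (μ : ℂ) :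
    complexConj (Module.End.eigenspace (f.baseChange ℂ) μ) =
      Module.End.eigenspace (f.baseChange ℂ) (starRingEnd ℂ μ) := by
  ext x
  simp only [mem_complexConj, Module.End.mem_eigenspace_iff]
  constructor
  · intro h
    have h' := congrArg conj h
    rwa [← conj_baseChange, conj_conj, conj_smul, conj_conj] at h'
  · intro h
    rw [← conj_baseChange, h, conj_smul, starRingEnd_self_apply]

/-- Discharge of the named fact `complexConj_eigenPiece`: `conj (V^{p,q}_σ) = V^{q,p}_{σ̄}`.
Deligne, *Hodge cycles on abelian varieties* (LNM 900), §4, p. 30 of Milne's TeXed notes: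
`H¹_B(A) ⊗ ℂ = ⊕_{σ ∈ Hom(E,ℂ)} H¹_{B,σ}` with `e ∈ E` acting on `H¹_{B,σ}` as `σ(e)`, each
`H¹_{B,σ} = H^{1,0}_σ ⊕ H^{0,1}_σ`; combined with Hodge symmetry `conj V^{p,q} = V^{q,p}`
(ibid. §2, p. 23). Proof: `complexConj` is a lattice automorphism (`complexConjOrderIso`), so
commutes with `⊓` and `⨅`; on the Hodge piece use `complexConj_piece`, on each eigenspace
`complexConj_eigenspace_baseChange` and `σ̄(e) = conj (σ e)`
(`NumberField.ComplexEmbedding.conjugate_coe_eq`). [cite: DeligneLNM900, §4 (p. 30, decomposition `H¹_B ⊗ ℂ = ⊕_σ H¹_{B,σ}`)] -/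
theorem complexConj_eigenPiece_holds : complexConj_eigenPiece (H := H) (E := E) := by
  intro A σ p q
  simp only [eigenPiece]
  rw [complexConj_inf, complexConj_piece, ← complexConjOrderIso_apply (⨅ e : E, _),
    OrderIso.map_iInf]
  congr 1
  refine iInf_congr fun e => ?_
  rw [complexConjOrderIso_apply, complexConj_eigenspace_baseChange,
    NumberField.ComplexEmbedding.conjugate_coe_eq]

/-- The Hodge piece is the direct sum of its `σ`-eigenspaces: independence
(`E ⊗_ℚ ℂ ≅ ℂ^{Hom(E,ℂ)}`; Deligne, LNM 900, §4). [cite: DeligneLNM900, §4] -/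
def iSupIndep_eigenPiece : Prop :=
  ∀ (A : EndAction H E) (p q : ℤ),
    iSupIndep fun σ : E →+* ℂ => A.eigenPiece σ p q

/-- The Hodge piece is the direct sum of its `σ`-eigenspaces: spanning
(`E ⊗_ℚ ℂ ≅ ℂ^{Hom(E,ℂ)}`; Deligne, LNM 900, §4). [cite: DeligneLNM900, §4] -/
def iSup_eigenPiece : Prop :=
  ∀ (A : EndAction H E) (p q : ℤ),
    ⨆ σ : E →+* ℂ, A.eigenPiece σ p q = H.piece p q

/-- The **space of Weil classes** `W_E = ⋀^g_E V ⊂ ⋀^g_ℚ V` of an `E`-action with `E`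
(imaginary) quadratic and `dim_E V = g` (Weil 1977; Moonen–Zarhin, Duke 77 (1995), §2.4;
van Geemen 1994, §5.2), defined for any `E`, `g` by the infinitesimal characterisation:
`x ∈ W_E` iff for every `e ∈ E`,
`D_e (D_e x) - g·tr_{E/ℚ}(e)·D_e x + g²·N_{E/ℚ}(e)·x = 0`,
where `D_e = derivationExteriorPower (ι e) g` is the derivation action of `e` on `⋀^g_ℚ V`.

Justification (quadratic `E`, `σ, σ̄ : E → ℂ`): `V_ℂ = V_σ ⊕ V_σ̄` and
`⋀^g V_ℂ = ⊕_{a+b=g} ⋀^a V_σ ⊗ ⋀^b V_σ̄`, on whose `(a,b)`-summand `D_e` is the scalar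
`a σ(e) + b σ̄(e)`; the displayed operator is `(D_e - g σ(e))(D_e - g σ̄(e))`, acting by
`-ab (σ(e) - σ̄(e))²`, so its kernel for a generator `e` is the sum of the `(g,0)` and `(0,g)`
summands, i.e. `(⋀^g_E V) ⊗ ℂ`, on which `E^×` acts through the character `Nm ∘ det_E`.
For `g = 0` the definition gives all of `⋀^0 V = ℚ` (junk case). [cite: Weil1977] -/
def weilClasses (A : EndAction H E) (g : ℕ) : Submodule ℚ (⋀[ℚ]^g V) :=
  ⨅ e : E, LinearMap.ker
    (derivationExteriorPower (A.ι e : Module.End ℚ V) g *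
        derivationExteriorPower (A.ι e : Module.End ℚ V) g -
      ((g : ℚ) * Algebra.trace ℚ E e) • derivationExteriorPower (A.ι e : Module.End ℚ V) g +
      ((g : ℚ) ^ 2 * Algebra.norm ℚ e) • (1 : Module.End ℚ (⋀[ℚ]^g V)))

/-- Membership in `weilClasses`: the infinitesimal characterisation. [folklore] -/
theorem mem_weilClasses_iff (A : EndAction H E) (g : ℕ) (x : ⋀[ℚ]^g V) :
    x ∈ A.weilClasses g ↔ ∀ e : E,
      derivationExteriorPower (A.ι e : Module.End ℚ V) g
          (derivationExteriorPower (A.ι e : Module.End ℚ V) g x) -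
        ((g : ℚ) * Algebra.trace ℚ E e) • derivationExteriorPower (A.ι e : Module.End ℚ V) g x +
        ((g : ℚ) ^ 2 * Algebra.norm ℚ e) • x = 0 := by
  simp [weilClasses, Submodule.mem_iInf]

end General

section WeightOne

variable {H : HodgeStructure V 1}

/-- The multiplicity `n_σ = dim_ℂ V^{1,0}_σ` with which the embedding `σ : E → ℂ` occurs in
`V^{1,0}` (Deligne, LNM 900, §4; Moonen–Zarhin 1995, §2.2–2.3, the function `σ ↦ n_σ`).
Junk value `0` if infinite-dimensional. [cite: MoonenZarhin1995, §2.2–2.3  the function  σ ↦ n_σ] -/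
def multiplicity (A : EndAction H E) (σ : E →+* ℂ) : ℕ :=
  Module.finrank ℂ (A.eigenPiece σ 1 0)

/-- `n_σ + n_σ̄ = dim_E V` when `V` is finite-dimensional: `V_ℂ,σ = V^{1,0}_σ ⊕ V^{0,1}_σ`, and
`conj : V^{0,1}_σ ≃ V^{1,0}_σ̄` antilinearly, while `dim_ℂ V_ℂ,σ = dim_E V`
(Deligne, LNM 900, §4; Moonen–Zarhin 1995, 2.2). Effectivity of `H` (only types `(1,0)`,
`(0,1)`) is needed for the first equality. [cite: MoonenZarhin1995, 2.2] -/
def multiplicity_add_multiplicity_conjugate : Prop :=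
  ∀ [FiniteDimensional ℚ V] (hH : H.IsEffective) (A : EndAction H E) (σ : E →+* ℂ),
    (A.multiplicity σ + A.multiplicity (NumberField.ComplexEmbedding.conjugate σ)) *
      Module.finrank ℚ E = Module.finrank ℚ V

/-- The `E`-Hodge structure of weight `1` is **of Weil type**: `E` is an imaginary quadratic
field and both embeddings `σ, σ̄ : E → ℂ` occur in `V^{1,0}` with the same multiplicity
`n_σ = n_σ̄ = dim V^{1,0} / 2` (Weil 1977; van Geemen 1994, §5; Moonen–Zarhin, Duke 77 (1995),
§2.4 and (2.7)). We include that `H` is effective (types `(1,0), (0,1)` only) and `V`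
finite-dimensional, as for `H¹` of an abelian variety (otherwise the multiplicity condition is
vacuous, all `finrank`s being junk `0`). [cite: Weil1977] -/
def IsOfWeilType (A : EndAction H E) : Prop :=
  H.IsEffective ∧ FiniteDimensional ℚ V ∧
    NumberField.IsTotallyComplex E ∧ Module.finrank ℚ E = 2 ∧
    ∀ σ : E →+* ℂ, 2 * A.multiplicity σ = Module.finrank ℂ (H.piece 1 0)

/-- For an action of Weil type with `dim_ℚ V = 2g`, `g > 0`, the space of Weil classes
`W_E = ⋀^g_E V` is `2`-dimensional over `ℚ` (a line over `E`)
(Moonen–Zarhin, Duke 77 (1995), §2.4; van Geemen 1994, 5.2). Only `[E : ℚ] = 2` is used. [cite: Geemen1994, 5.2] -/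
def finrank_weilClasses : Prop :=
  ∀ (A : EndAction H E) (hA : A.IsOfWeilType) {g : ℕ} (hg : 0 < g) (hV : Module.finrank ℚ V = 2 * g),
    Module.finrank ℚ (A.weilClasses g) = 2

/-- The `E`-vector space structure on `V` given by the action `ι` (a `def`, not an instance;
use with `letI`). [folklore] -/
abbrev module (A : EndAction H E) : Module E V :=
  Module.compHom V (A.ι : E →+* Module.End ℚ V)

/-- The `E`-Hodge structure of weight `1` is **of CM type by the CM field `E`**: `H` is
effective (types `(1,0), (0,1)` only, as for `H¹` of an abelian variety), `E` is a CM field and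
`V` is a line over `E` (via `ι`), equivalently `dim_ℚ V = [E : ℚ]`
(Shimura–Taniyama; Deligne, LNM 900, §5; Milne, *Complex Multiplication*, §1–3).

This is the simple case, `E` a CM *field* with `[E : ℚ] = dim V`, which is what statements
about simple CM abelian varieties use. The gap inventory's general CM data are CM *algebras*
(products of CM fields acting on an isotypic decomposition); that semisimple-algebra version is
deferred. [folklore] -/
def IsCM (A : EndAction H E) : Prop :=
  H.IsEffective ∧ NumberField.IsCMField E ∧ letI := A.module; Module.finrank E V = 1

/-- The CM type of an `E`-action: the set `Φ = {σ : E → ℂ | n_σ = 1}` of embeddings occurring in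
`V^{1,0}` (for `IsCM A`, all `n_σ ∈ {0, 1}` and `V^{1,0} = ⊕_{σ ∈ Φ} V_ℂ,σ`)
(Deligne, LNM 900, §5; Milne, *Complex Multiplication*, §1). For `hA : IsCM A` it is a CM type,
`⟨A.cmType, A.mem_cmType_iff_conjugate_notMem hA⟩ : CMType E`; we do not package this as a
`def` since its proof component is (for now) sorried. [folklore] -/
def cmType (A : EndAction H E) : Set (E →+* ℂ) :=
  {σ | A.multiplicity σ = 1}

/-- Membership in `cmType`. [folklore] -/
theorem mem_cmType_iff (A : EndAction H E) (σ : E →+* ℂ) :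
    σ ∈ A.cmType ↔ A.multiplicity σ = 1 := Iff.rfl

/-- For a CM action, `Φ = cmType A` is a CM type: `Φ ⊔ Φ̄ = Hom(E, ℂ)` and `Φ ∩ Φ̄ = ∅`, i.e.
`σ ∈ Φ ↔ σ̄ ∉ Φ` (Deligne, LNM 900, §5; Milne, *Complex Multiplication*, Prop. 1.5/§3):
by `multiplicity_add_multiplicity_conjugate` (using effectivity, part of `IsCM`),
`n_σ + n_σ̄ = 1`. [cite: DeligneLNM900, §5] -/
def mem_cmType_iff_conjugate_notMem : Prop :=
  ∀ (A : EndAction H E) (hA : A.IsCM) (σ : E →+* ℂ),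
    σ ∈ A.cmType ↔ NumberField.ComplexEmbedding.conjugate σ ∉ A.cmType

end WeightOne

end EndAction

end HodgeStructure

/-- A **CM type** of the (number) field `E`: a set `Φ` of complex embeddings containing exactly one
of each pair `{φ, φ̄}` of complex-conjugate embeddings (Shimura–Taniyama; Milne, *Complex
Multiplication*, §1; Deligne, LNM 900, §5). Nonempty only if `E` is totally complex. [folklore] -/
def CMType (E : Type*) [Field E] : Type _ :=
  {Φ : Set (E →+* ℂ) // ∀ φ, φ ∈ Φ ↔ NumberField.ComplexEmbedding.conjugate φ ∉ Φ}

end Literature.AlgebraicGeometry.Motives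

end
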